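import Literature.Topology.FourManifolds.KhSurgeryStates
import Literature.Topology.FourManifolds.KhResolutionsProofs
import HarnessLib

/-!
# The triangle of the third Reidemeister move on a Gauss diagram: positions, arcs, gluings

Sibling file of `KhComplex.lean`, opening the third Reidemeister move (`PolyakMove.omega3a`:
`G ↦ G.braidMove x y z` for three positive chords `x y z` whose six passages form three
adjacent pairs) in the invariance programme for
`Literature.Topology.FourManifolds.GaussDiagram.nonempty_iso_khovanovHomology_of_equiv`
(Khovanov (2000), Thm. 1, §5.4; Bar-Natan (2002), §4.4). Unlike the first two moves no chord is
inserted: `G.braidMove x y z` has the same chords, arcs and states as `G`, and only the gluings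
at the six local passages change. This file records that bookkeeping:

* the passages of `x, y, z` in `G.braidMove x y z` (`overPos_braidMove_x`, …: on each of the three
  strands the order of its two passages is reversed) and of the other chords (unchanged);
* the nine local arcs: the three **sides of the triangle** `sideA` (from `overPos x` to
  `overPos y`), `sideB` (from `underPos x` to `overPos z`), `sideC` (from `underPos y` to
  `underPos z`) and the six ends `inA, outA, inB, outB, inC, outC`;
* `reachable_map_of_adj` — the abstract transfer principle used downstream to compare state
  circles of `G` and `G.braidMove x y z`: a map of arcs under which every gluing of one state
  graph becomes a connection of the other carries reachability to reachability.

No named fact is introduced.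

## References

* M. Khovanov, *A categorification of the Jones polynomial*, Duke Math. J. 101 (2000) 359–426,
  §5.4. [cite: Khovanov2000, §5.4]
* D. Bar-Natan, *On Khovanov's categorification of the Jones polynomial*, Algebr. Geom. Topol. 2
  (2002) 337–370, §4.4. [cite: BarNatan2002, §4]
* M. Polyak, *Minimal generating sets of Reidemeister moves*, Quantum Topol. 1 (2010), §2, Fig. 1
  (`Ω3a`). [cite: Polyak2010, §2]
-/

open Function

noncomputable section

namespace Literature.Topology.FourManifolds

namespace GaussDiagram

/-! ## Transfer of reachability along a map of arcs -/

/-- **Transfer of reachability.** If a map `π` of vertices sends every edge of the graph `Γ₁`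
to a pair of vertices connected in `Γ₂`, it sends connected vertices of `Γ₁` to connected
vertices of `Γ₂`. [folklore] -/
theorem reachable_map_of_adj {V W : Type*} {Γ₁ : SimpleGraph V} {Γ₂ : SimpleGraph W} (π : V → W)
    (h : ∀ u v, Γ₁.Adj u v → Γ₂.Reachable (π u) (π v)) {u v : V} (huv : Γ₁.Reachable u v) :
    Γ₂.Reachable (π u) (π v) := by
  obtain ⟨w⟩ := huv
  induction w with
  | nil => rfl
  | cons hadj _ ih => exact (h _ _ hadj).trans ih

variable (G : GaussDiagram) (x y z : Fin G.n)

/-! ## Passages of the braid rearrangement -/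

/-- The permutation of positions of the braid rearrangement. [folklore] -/
def braidPerm : Equiv.Perm (Fin (2 * G.n)) :=
  Equiv.swap (G.overPos x) (G.overPos y) * Equiv.swap (G.underPos x) (G.overPos z) *
    Equiv.swap (G.underPos y) (G.underPos z)

/-- `braidMove` is `mapPos braidPerm`. [folklore] -/
theorem braidMove_eq : G.braidMove x y z = G.mapPos (G.braidPerm x y z) := rfl

/-- The braid rearrangement keeps the number of chords. [folklore] -/
@[simp] theorem braidMove_n : (G.braidMove x y z).n = G.n := rfl

/-- The value of the braid permutation. [folklore] -/
theorem braidPerm_apply (p : Fin (2 * G.n)) :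
    G.braidPerm x y z p = Equiv.swap (G.overPos x) (G.overPos y)
      (Equiv.swap (G.underPos x) (G.overPos z) (Equiv.swap (G.underPos y) (G.underPos z) p)) := rfl

variable {x y z} (hxy : x ≠ y) (hxz : x ≠ z) (hyz : y ≠ z)

include hxz in
/-- In the braid rearrangement `x` passes over at the old over-passage of `y`. [folklore] -/
theorem overPos_braidMove_x : (G.braidMove x y z).overPos x = G.overPos y := by
  show (G.mapPos (G.braidPerm x y z)).overPos _ = _
  rw [mapPos_overPos, braidPerm_apply,
    Equiv.swap_apply_of_ne_of_ne (G.overPos_ne_underPos x y) (G.overPos_ne_underPos x z),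
    Equiv.swap_apply_of_ne_of_ne (G.overPos_ne_underPos x x)
      (fun h ↦ hxz (G.overPos_injective h)),
    Equiv.swap_apply_left]

include hyz in
/-- In the braid rearrangement `y` passes over at the old over-passage of `x`. [folklore] -/
theorem overPos_braidMove_y : (G.braidMove x y z).overPos y = G.overPos x := by
  show (G.mapPos (G.braidPerm x y z)).overPos _ = _
  rw [mapPos_overPos, braidPerm_apply,
    Equiv.swap_apply_of_ne_of_ne (G.overPos_ne_underPos y y) (G.overPos_ne_underPos y z),
    Equiv.swap_apply_of_ne_of_ne (G.overPos_ne_underPos y x)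
      (fun h ↦ hyz (G.overPos_injective h)),
    Equiv.swap_apply_right]

include hxy hxz hyz in
/-- In the braid rearrangement `x` passes under at the old over-passage of `z`. [folklore] -/
theorem underPos_braidMove_x : (G.braidMove x y z).underPos x = G.overPos z := by
  show (G.mapPos (G.braidPerm x y z)).underPos _ = _
  rw [mapPos_underPos, braidPerm_apply,
    Equiv.swap_apply_of_ne_of_ne (fun h ↦ hxy (G.underPos_injective h))
      (fun h ↦ hxz (G.underPos_injective h)),
    Equiv.swap_apply_left,
    Equiv.swap_apply_of_ne_of_ne (fun h ↦ hxz (G.overPos_injective h).symm)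
      (fun h ↦ hyz (G.overPos_injective h).symm)]

/-- In the braid rearrangement `z` passes over at the old under-passage of `x`. [folklore] -/
theorem overPos_braidMove_z : (G.braidMove x y z).overPos z = G.underPos x := by
  show (G.mapPos (G.braidPerm x y z)).overPos _ = _
  rw [mapPos_overPos, braidPerm_apply,
    Equiv.swap_apply_of_ne_of_ne (G.overPos_ne_underPos z y) (G.overPos_ne_underPos z z),
    Equiv.swap_apply_right,
    Equiv.swap_apply_of_ne_of_ne (G.overPos_ne_underPos x x).symm (G.overPos_ne_underPos y x).symm]

include hxz in
/-- In the braid rearrangement `y` passes under at the old under-passage of `z`. [folklore] -/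
theorem underPos_braidMove_y : (G.braidMove x y z).underPos y = G.underPos z := by
  show (G.mapPos (G.braidPerm x y z)).underPos _ = _
  rw [mapPos_underPos, braidPerm_apply, Equiv.swap_apply_left,
    Equiv.swap_apply_of_ne_of_ne (fun h ↦ hxz (G.underPos_injective h).symm)
      (G.overPos_ne_underPos z z).symm,
    Equiv.swap_apply_of_ne_of_ne (G.overPos_ne_underPos x z).symm (G.overPos_ne_underPos y z).symm]

include hxy in
/-- In the braid rearrangement `z` passes under at the old under-passage of `y`. [folklore] -/
theorem underPos_braidMove_z : (G.braidMove x y z).underPos z = G.underPos y := by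
  show (G.mapPos (G.braidPerm x y z)).underPos _ = _
  rw [mapPos_underPos, braidPerm_apply, Equiv.swap_apply_right,
    Equiv.swap_apply_of_ne_of_ne (fun h ↦ hxy (G.underPos_injective h).symm)
      (G.overPos_ne_underPos z y).symm,
    Equiv.swap_apply_of_ne_of_ne (G.overPos_ne_underPos x y).symm (G.overPos_ne_underPos y y).symm]

/-- The braid permutation fixes the passages of the other chords. [folklore] -/
theorem braidPerm_apply_of_ne {i : Fin G.n} (hix : i ≠ x) (hiy : i ≠ y) (hiz : i ≠ z)
    (p : Fin (2 * G.n)) (hp : p = G.overPos i ∨ p = G.underPos i) : G.braidPerm x y z p = p := by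
  rw [braidPerm_apply]
  rcases hp with rfl | rfl
  · rw [Equiv.swap_apply_of_ne_of_ne (G.overPos_ne_underPos i y) (G.overPos_ne_underPos i z),
      Equiv.swap_apply_of_ne_of_ne (G.overPos_ne_underPos i x)
        (fun h ↦ hiz (G.overPos_injective h)),
      Equiv.swap_apply_of_ne_of_ne (fun h ↦ hix (G.overPos_injective h))
        (fun h ↦ hiy (G.overPos_injective h))]
  · rw [Equiv.swap_apply_of_ne_of_ne (fun h ↦ hiy (G.underPos_injective h))
        (fun h ↦ hiz (G.underPos_injective h)),
      Equiv.swap_apply_of_ne_of_ne (fun h ↦ hix (G.underPos_injective h))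
        (G.overPos_ne_underPos z i).symm,
      Equiv.swap_apply_of_ne_of_ne (G.overPos_ne_underPos x i).symm (G.overPos_ne_underPos y i).symm]

/-- The other chords keep their over-passages. [folklore] -/
theorem overPos_braidMove_of_ne {i : Fin G.n} (hix : i ≠ x) (hiy : i ≠ y) (hiz : i ≠ z) :
    (G.braidMove x y z).overPos i = G.overPos i := by
  show (G.mapPos (G.braidPerm x y z)).overPos _ = _
  rw [mapPos_overPos, G.braidPerm_apply_of_ne hix hiy hiz _ (Or.inl rfl)]

/-- The other chords keep their under-passages. [folklore] -/
theorem underPos_braidMove_of_ne {i : Fin G.n} (hix : i ≠ x) (hiy : i ≠ y) (hiz : i ≠ z) :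
    (G.braidMove x y z).underPos i = G.underPos i := by
  show (G.mapPos (G.braidPerm x y z)).underPos _ = _
  rw [mapPos_underPos, G.braidPerm_apply_of_ne hix hiy hiz _ (Or.inr rfl)]

/-- The braid rearrangement keeps the signs. [folklore] -/
@[simp] theorem sign_braidMove (i : Fin G.n) : (G.braidMove x y z).sign i = G.sign i := rfl


/-! ## The local positions and arcs of the triangle -/

section Local

variable (x y z)
variable (ha : (G.overPos y : ℕ) = G.overPos x + 1) (hb : (G.overPos z : ℕ) = G.underPos x + 1)
  (hc : (G.underPos z : ℕ) = G.underPos y + 1)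

/-- **The first side of the triangle**: the arc from `overPos x` to `overPos y` (on the strand
passing over `x` and `y`). Khovanov (2000), §5.4; Bar-Natan (2002), §4.4. [cite: Khovanov2000, §5.4] -/
def sideA : G.Arc := G.arcOut (G.overPos x)

/-- **The second side of the triangle**: the arc from `underPos x` to `overPos z`. [cite: Khovanov2000, §5.4] -/
def sideB : G.Arc := G.arcOut (G.underPos x)

/-- **The third side of the triangle**: the arc from `underPos y` to `underPos z`. [cite: Khovanov2000, §5.4] -/
def sideC : G.Arc := G.arcOut (G.underPos y)

/-- The arc entering the first pair of local passages. [folklore] -/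
def inA : G.Arc := G.arcIn (G.overPos x)

/-- The arc leaving the first pair of local passages. [folklore] -/
def outA : G.Arc := G.arcOut (G.overPos y)

/-- The arc entering the second pair of local passages. [folklore] -/
def inB : G.Arc := G.arcIn (G.underPos x)

/-- The arc leaving the second pair of local passages. [folklore] -/
def outB : G.Arc := G.arcOut (G.overPos z)

/-- The arc entering the third pair of local passages. [folklore] -/
def inC : G.Arc := G.arcIn (G.underPos y)

/-- The arc leaving the third pair of local passages. [folklore] -/
def outC : G.Arc := G.arcOut (G.underPos z)

variable {x y z}

include ha in
/-- `overPos y` is the cyclic successor of `overPos x`. [folklore] -/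
theorem overPos_y_eq_succPt : G.overPos y = G.succPt (G.overPos x) := by
  apply Fin.ext
  show (G.overPos y : ℕ) = ((G.overPos x : ℕ) + 1) % (2 * G.n)
  rw [Nat.mod_eq_of_lt (by have := (G.overPos y).isLt; omega), ha]

include hb in
/-- `overPos z` is the cyclic successor of `underPos x`. [folklore] -/
theorem overPos_z_eq_succPt : G.overPos z = G.succPt (G.underPos x) := by
  apply Fin.ext
  show (G.overPos z : ℕ) = ((G.underPos x : ℕ) + 1) % (2 * G.n)
  rw [Nat.mod_eq_of_lt (by have := (G.overPos z).isLt; omega), hb]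

include hc in
/-- `underPos z` is the cyclic successor of `underPos y`. [folklore] -/
theorem underPos_z_eq_succPt : G.underPos z = G.succPt (G.underPos y) := by
  apply Fin.ext
  show (G.underPos z : ℕ) = ((G.underPos y : ℕ) + 1) % (2 * G.n)
  rw [Nat.mod_eq_of_lt (by have := (G.underPos z).isLt; omega), hc]

include ha in
/-- The arc entering `overPos y` is the first side. [folklore] -/
@[simp] theorem arcIn_overPos_y : G.arcIn (G.overPos y) = G.sideA x := by
  rw [G.overPos_y_eq_succPt ha, arcIn_succPt]; rfl

include hb in
/-- The arc entering `overPos z` is the second side. [folklore] -/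
@[simp] theorem arcIn_overPos_z : G.arcIn (G.overPos z) = G.sideB x := by
  rw [G.overPos_z_eq_succPt hb, arcIn_succPt]; rfl

include hc in
/-- The arc entering `underPos z` is the third side. [folklore] -/
@[simp] theorem arcIn_underPos_z : G.arcIn (G.underPos z) = G.sideC y := by
  rw [G.underPos_z_eq_succPt hc, arcIn_succPt]; rfl

include ha in
/-- `x ≠ y`. [folklore] -/
theorem x_ne_y : x ≠ y := by
  rintro rfl; omega

include hc in
/-- `y ≠ z`. [folklore] -/
theorem y_ne_z : y ≠ z := by
  rintro rfl; omega

/-! ## The gluing clauses of `G` at the six local passages -/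

section GlueG

variable (hx : G.sign x = 1) (hy : G.sign y = 1) (hz : G.sign z = 1) (τ : G.State)

include hx in
/-- The Seifert bit of a positive chord is its `0`-smoothing. [folklore] -/
theorem isSeifert_of_sign_x : G.isSeifert τ x = (τ x == false) := by
  unfold isSeifert; rw [hx]; cases τ x <;> rfl

include hx in
/-- The gluing clause of `G` at `overPos x`. [folklore] -/
theorem glueRel_overPos_x (u v : G.Arc) :
    G.glueRel τ (G.overPos x) u v ↔
      (τ x = false ∧ ((u = G.inA x ∧ v = G.sideB x) ∨ (v = G.inA x ∧ u = G.sideB x))) ∨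
        (τ x = true ∧ ((u = G.inA x ∧ v = G.inB x) ∨ (u = G.sideA x ∧ v = G.sideB x))) := by
  simp only [glueRel, chordOf_overPos, partner_overPos, G.isSeifert_of_sign_x hx]
  cases τ x <;> simp [inA, inB, sideA, sideB]

include hx in
/-- The gluing clause of `G` at `underPos x`. [folklore] -/
theorem glueRel_underPos_x (u v : G.Arc) :
    G.glueRel τ (G.underPos x) u v ↔
      (τ x = false ∧ ((u = G.inB x ∧ v = G.sideA x) ∨ (v = G.inB x ∧ u = G.sideA x))) ∨
        (τ x = true ∧ ((u = G.inB x ∧ v = G.inA x) ∨ (u = G.sideB x ∧ v = G.sideA x))) := by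
  simp only [glueRel, chordOf_underPos, partner_underPos, G.isSeifert_of_sign_x hx]
  cases τ x <;> simp [inA, inB, sideA, sideB]

include hy ha in
/-- The gluing clause of `G` at `overPos y`. [folklore] -/
theorem glueRel_overPos_y (u v : G.Arc) :
    G.glueRel τ (G.overPos y) u v ↔
      (τ y = false ∧ ((u = G.sideA x ∧ v = G.sideC y) ∨ (v = G.sideA x ∧ u = G.sideC y))) ∨
        (τ y = true ∧ ((u = G.sideA x ∧ v = G.inC y) ∨ (u = G.outA y ∧ v = G.sideC y))) := by
  simp only [glueRel, chordOf_overPos, partner_overPos, G.isSeifert_of_sign_x hy,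
    G.arcIn_overPos_y ha]
  cases τ y <;> simp [inC, outA, sideC]

include hy ha in
/-- The gluing clause of `G` at `underPos y`. [folklore] -/
theorem glueRel_underPos_y (u v : G.Arc) :
    G.glueRel τ (G.underPos y) u v ↔
      (τ y = false ∧ ((u = G.inC y ∧ v = G.outA y) ∨ (v = G.inC y ∧ u = G.outA y))) ∨
        (τ y = true ∧ ((u = G.inC y ∧ v = G.sideA x) ∨ (u = G.sideC y ∧ v = G.outA y))) := by
  simp only [glueRel, chordOf_underPos, partner_underPos, G.isSeifert_of_sign_x hy,
    G.arcIn_overPos_y ha]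
  cases τ y <;> simp [inC, outA, sideC]

include hz hb hc in
/-- The gluing clause of `G` at `overPos z`. [folklore] -/
theorem glueRel_overPos_z (u v : G.Arc) :
    G.glueRel τ (G.overPos z) u v ↔
      (τ z = false ∧ ((u = G.sideB x ∧ v = G.outC z) ∨ (v = G.sideB x ∧ u = G.outC z))) ∨
        (τ z = true ∧ ((u = G.sideB x ∧ v = G.sideC y) ∨ (u = G.outB z ∧ v = G.outC z))) := by
  simp only [glueRel, chordOf_overPos, partner_overPos, G.isSeifert_of_sign_x hz,
    G.arcIn_overPos_z hb, G.arcIn_underPos_z hc]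
  cases τ z <;> simp [outB, outC]

include hz hb hc in
/-- The gluing clause of `G` at `underPos z`. [folklore] -/
theorem glueRel_underPos_z (u v : G.Arc) :
    G.glueRel τ (G.underPos z) u v ↔
      (τ z = false ∧ ((u = G.sideC y ∧ v = G.outB z) ∨ (v = G.sideC y ∧ u = G.outB z))) ∨
        (τ z = true ∧ ((u = G.sideC y ∧ v = G.sideB x) ∨ (u = G.outC z ∧ v = G.outB z))) := by
  simp only [glueRel, chordOf_underPos, partner_underPos, G.isSeifert_of_sign_x hz,
    G.arcIn_overPos_z hb, G.arcIn_underPos_z hc]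
  cases τ z <;> simp [outB, outC]

end GlueG

end Local


/-! ## The gluing clauses of `G.braidMove x y z` at the six local passages -/

section GlueG'

variable (ha : (G.overPos y : ℕ) = G.overPos x + 1) (hb : (G.overPos z : ℕ) = G.underPos x + 1)
  (hc : (G.underPos z : ℕ) = G.underPos y + 1)
  (hx : G.sign x = 1) (hy : G.sign y = 1) (hz : G.sign z = 1) (τ : G.State)

/-- The Seifert bits of the braid rearrangement are those of `G`. [folklore] -/
theorem isSeifert_braidMove (i : Fin G.n) : (G.braidMove x y z).isSeifert τ i = G.isSeifert τ i := rfl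

/-- The arcs entering marked points are the same in the braid rearrangement. [folklore] -/
theorem arcIn_braidMove (p : Fin (2 * G.n)) : (G.braidMove x y z).arcIn p = G.arcIn p := rfl

/-- The arcs leaving marked points are the same in the braid rearrangement. [folklore] -/
theorem arcOut_braidMove (p : Fin (2 * G.n)) : (G.braidMove x y z).arcOut p = G.arcOut p := rfl

include hxz in
/-- The chord of the braid rearrangement through `overPos y` is `x`. [folklore] -/
theorem chordOf_braidMove_overPos_y : (G.braidMove x y z).chordOf (G.overPos y) = x := by
  have h := (G.braidMove x y z).chordOf_overPos x
  rwa [G.overPos_braidMove_x hxz] at h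

include hc in
/-- The chord of the braid rearrangement through `overPos x` is `y`. [folklore] -/
theorem chordOf_braidMove_overPos_x : (G.braidMove x y z).chordOf (G.overPos x) = y := by
  have h := (G.braidMove x y z).chordOf_overPos y
  rwa [G.overPos_braidMove_y (G.y_ne_z hc)] at h

include hxz ha hc in
/-- The chord of the braid rearrangement through `overPos z` is `x`. [folklore] -/
theorem chordOf_braidMove_overPos_z : (G.braidMove x y z).chordOf (G.overPos z) = x := by
  have h := (G.braidMove x y z).chordOf_underPos x
  rwa [G.underPos_braidMove_x (G.x_ne_y ha) hxz (G.y_ne_z hc)] at h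

/-- The chord of the braid rearrangement through `underPos x` is `z`. [folklore] -/
theorem chordOf_braidMove_underPos_x : (G.braidMove x y z).chordOf (G.underPos x) = z := by
  have h := (G.braidMove x y z).chordOf_overPos z
  rwa [G.overPos_braidMove_z] at h

include hxz in
/-- The chord of the braid rearrangement through `underPos z` is `y`. [folklore] -/
theorem chordOf_braidMove_underPos_z : (G.braidMove x y z).chordOf (G.underPos z) = y := by
  have h := (G.braidMove x y z).chordOf_underPos y
  rwa [G.underPos_braidMove_y hxz] at h

include ha in
/-- The chord of the braid rearrangement through `underPos y` is `z`. [folklore] -/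
theorem chordOf_braidMove_underPos_y : (G.braidMove x y z).chordOf (G.underPos y) = z := by
  have h := (G.braidMove x y z).chordOf_underPos z
  rwa [G.underPos_braidMove_z (G.x_ne_y ha)] at h

include hxz ha hc in
/-- The partner of `overPos y` in the braid rearrangement is `overPos z`. [folklore] -/
theorem partner_braidMove_overPos_y : (G.braidMove x y z).partner (G.overPos y) = G.overPos z := by
  have h := (G.braidMove x y z).partner_overPos x
  rwa [G.overPos_braidMove_x hxz, G.underPos_braidMove_x (G.x_ne_y ha) hxz (G.y_ne_z hc)] at h

include hxz ha hc in
/-- The partner of `overPos z` in the braid rearrangement is `overPos y`. [folklore] -/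
theorem partner_braidMove_overPos_z : (G.braidMove x y z).partner (G.overPos z) = G.overPos y := by
  rw [← G.partner_braidMove_overPos_y hxz ha hc, partner_partner]

include hxz hc in
/-- The partner of `overPos x` in the braid rearrangement is `underPos z`. [folklore] -/
theorem partner_braidMove_overPos_x : (G.braidMove x y z).partner (G.overPos x) = G.underPos z := by
  have h := (G.braidMove x y z).partner_overPos y
  rwa [G.overPos_braidMove_y (G.y_ne_z hc), G.underPos_braidMove_y hxz] at h

include hxz hc in
/-- The partner of `underPos z` in the braid rearrangement is `overPos x`. [folklore] -/
theorem partner_braidMove_underPos_z : (G.braidMove x y z).partner (G.underPos z) = G.overPos x := by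
  rw [← G.partner_braidMove_overPos_x hxz hc, partner_partner]

include ha in
/-- The partner of `underPos x` in the braid rearrangement is `underPos y`. [folklore] -/
theorem partner_braidMove_underPos_x : (G.braidMove x y z).partner (G.underPos x) = G.underPos y := by
  have h := (G.braidMove x y z).partner_overPos z
  rwa [G.overPos_braidMove_z, G.underPos_braidMove_z (G.x_ne_y ha)] at h

include ha in
/-- The partner of `underPos y` in the braid rearrangement is `underPos x`. [folklore] -/
theorem partner_braidMove_underPos_y : (G.braidMove x y z).partner (G.underPos y) = G.underPos x := by
  rw [← G.partner_braidMove_underPos_x ha, partner_partner]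

include hxz ha hb hc hx in
/-- The gluing clause of the braid rearrangement at `overPos y` (passage of `x`). [folklore] -/
theorem glueRel_braidMove_overPos_y (u v : (G.braidMove x y z).Arc) :
    (G.braidMove x y z).glueRel τ (G.overPos y) u v ↔
      (τ x = false ∧ ((u = G.sideA x ∧ v = G.outB z) ∨ (v = G.sideA x ∧ u = G.outB z))) ∨
        (τ x = true ∧ ((u = G.sideA x ∧ v = G.sideB x) ∨ (u = G.outA y ∧ v = G.outB z))) := by
  simp only [glueRel, G.chordOf_braidMove_overPos_y hxz, G.partner_braidMove_overPos_y hxz ha hc,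
    isSeifert_braidMove, G.isSeifert_of_sign_x hx, arcIn_braidMove, arcOut_braidMove,
    G.arcIn_overPos_y ha, G.arcIn_overPos_z hb]
  cases τ x <;> simp [outA, outB]

include hxz ha hb hc hx in
/-- The gluing clause of the braid rearrangement at `overPos z` (passage of `x`). [folklore] -/
theorem glueRel_braidMove_overPos_z (u v : (G.braidMove x y z).Arc) :
    (G.braidMove x y z).glueRel τ (G.overPos z) u v ↔
      (τ x = false ∧ ((u = G.sideB x ∧ v = G.outA y) ∨ (v = G.sideB x ∧ u = G.outA y))) ∨
        (τ x = true ∧ ((u = G.sideB x ∧ v = G.sideA x) ∨ (u = G.outB z ∧ v = G.outA y))) := by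
  simp only [glueRel, G.chordOf_braidMove_overPos_z hxz ha hc, G.partner_braidMove_overPos_z hxz ha hc,
    isSeifert_braidMove, G.isSeifert_of_sign_x hx, arcIn_braidMove, arcOut_braidMove,
    G.arcIn_overPos_y ha, G.arcIn_overPos_z hb]
  cases τ x <;> simp [outA, outB]

include hxz hc hy in
/-- The gluing clause of the braid rearrangement at `overPos x` (passage of `y`). [folklore] -/
theorem glueRel_braidMove_overPos_x (u v : (G.braidMove x y z).Arc) :
    (G.braidMove x y z).glueRel τ (G.overPos x) u v ↔
      (τ y = false ∧ ((u = G.inA x ∧ v = G.outC z) ∨ (v = G.inA x ∧ u = G.outC z))) ∨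
        (τ y = true ∧ ((u = G.inA x ∧ v = G.sideC y) ∨ (u = G.sideA x ∧ v = G.outC z))) := by
  simp only [glueRel, G.chordOf_braidMove_overPos_x hc, G.partner_braidMove_overPos_x hxz hc,
    isSeifert_braidMove, G.isSeifert_of_sign_x hy, arcIn_braidMove, arcOut_braidMove,
    G.arcIn_underPos_z hc]
  cases τ y <;> simp [inA, sideA, outC]

include hxz hc hy in
/-- The gluing clause of the braid rearrangement at `underPos z` (passage of `y`). [folklore] -/
theorem glueRel_braidMove_underPos_z (u v : (G.braidMove x y z).Arc) :
    (G.braidMove x y z).glueRel τ (G.underPos z) u v ↔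
      (τ y = false ∧ ((u = G.sideC y ∧ v = G.sideA x) ∨ (v = G.sideC y ∧ u = G.sideA x))) ∨
        (τ y = true ∧ ((u = G.sideC y ∧ v = G.inA x) ∨ (u = G.outC z ∧ v = G.sideA x))) := by
  simp only [glueRel, G.chordOf_braidMove_underPos_z hxz, G.partner_braidMove_underPos_z hxz hc,
    isSeifert_braidMove, G.isSeifert_of_sign_x hy, arcIn_braidMove, arcOut_braidMove,
    G.arcIn_underPos_z hc]
  cases τ y <;> simp [inA, sideA, outC]

include ha hz in
/-- The gluing clause of the braid rearrangement at `underPos x` (passage of `z`). [folklore] -/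
theorem glueRel_braidMove_underPos_x (u v : (G.braidMove x y z).Arc) :
    (G.braidMove x y z).glueRel τ (G.underPos x) u v ↔
      (τ z = false ∧ ((u = G.inB x ∧ v = G.sideC y) ∨ (v = G.inB x ∧ u = G.sideC y))) ∨
        (τ z = true ∧ ((u = G.inB x ∧ v = G.inC y) ∨ (u = G.sideB x ∧ v = G.sideC y))) := by
  simp only [glueRel, G.chordOf_braidMove_underPos_x, G.partner_braidMove_underPos_x ha,
    isSeifert_braidMove, G.isSeifert_of_sign_x hz, arcIn_braidMove, arcOut_braidMove]
  cases τ z <;> simp [inB, inC, sideB, sideC]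

include ha hz in
/-- The gluing clause of the braid rearrangement at `underPos y` (passage of `z`). [folklore] -/
theorem glueRel_braidMove_underPos_y (u v : (G.braidMove x y z).Arc) :
    (G.braidMove x y z).glueRel τ (G.underPos y) u v ↔
      (τ z = false ∧ ((u = G.inC y ∧ v = G.sideB x) ∨ (v = G.inC y ∧ u = G.sideB x))) ∨
        (τ z = true ∧ ((u = G.inC y ∧ v = G.inB x) ∨ (u = G.sideC y ∧ v = G.sideB x))) := by
  simp only [glueRel, G.chordOf_braidMove_underPos_y ha, G.partner_braidMove_underPos_y ha,
    isSeifert_braidMove, G.isSeifert_of_sign_x hz, arcIn_braidMove, arcOut_braidMove]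
  cases τ z <;> simp [inB, inC, sideB, sideC]

end GlueG'


/-! ## The small circle of the triangle -/

section Loop

variable (ha : (G.overPos y : ℕ) = G.overPos x + 1) (hb : (G.overPos z : ℕ) = G.underPos x + 1)
  (hc : (G.underPos z : ℕ) = G.underPos y + 1)
  (hx : G.sign x = 1) (hy : G.sign y = 1) (hz : G.sign z = 1)

/-- An incoming arc is an outgoing arc only from the cyclic predecessor. [folklore] -/
theorem arcIn_eq_arcOut_iff (p q : Fin (2 * G.n)) : G.arcIn p = G.arcOut q ↔ p = G.succPt q := by
  constructor
  · intro h
    rw [← arcOut_predPt] at h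
    rw [← G.arcOut_injective h, succPt_predPt]
  · rintro rfl
    exact G.arcIn_succPt q

variable (x y z) in
/-- **Membership in the small circle**: being one of the three sides of the triangle. [folklore] -/
def InT (u : G.Arc) : Prop := u = G.sideA x ∨ u = G.sideB x ∨ u = G.sideC y

/-- The sides are sides. [folklore] -/
theorem inT_sideA : G.InT x y (G.sideA x) := Or.inl rfl
/-- The sides are sides. [folklore] -/
theorem inT_sideB : G.InT x y (G.sideB x) := Or.inr (Or.inl rfl)
/-- The sides are sides. [folklore] -/
theorem inT_sideC : G.InT x y (G.sideC y) := Or.inr (Or.inr rfl)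

/-- An outgoing arc is a side only from the start of a side. [folklore] -/
theorem inT_arcOut_iff (p : Fin (2 * G.n)) :
    G.InT x y (G.arcOut p) ↔ p = G.overPos x ∨ p = G.underPos x ∨ p = G.underPos y := by
  unfold InT sideA sideB sideC
  simp only [G.arcOut_injective.eq_iff]

include ha hb hc in
/-- An incoming arc is a side only into the end of a side. [folklore] -/
theorem inT_arcIn_iff (p : Fin (2 * G.n)) :
    G.InT x y (G.arcIn p) ↔ p = G.overPos y ∨ p = G.overPos z ∨ p = G.underPos z := by
  unfold InT sideA sideB sideC
  simp only [arcIn_eq_arcOut_iff, ← G.overPos_y_eq_succPt ha, ← G.overPos_z_eq_succPt hb,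
    ← G.underPos_z_eq_succPt hc]

include ha hb hc hxz in
/-- The arc entering `overPos x` is not a side. [folklore] -/
theorem not_inT_inA : ¬ G.InT x y (G.inA x) := by
  unfold inA; rw [G.inT_arcIn_iff ha hb hc]
  rintro (h | h | h)
  · exact G.x_ne_y ha (G.overPos_injective h)
  · exact hxz (G.overPos_injective h)
  · exact G.overPos_ne_underPos x z h

include ha in
/-- The arc leaving `overPos y` is not a side. [folklore] -/
theorem not_inT_outA : ¬ G.InT x y (G.outA y) := by
  unfold outA; rw [inT_arcOut_iff]
  rintro (h | h | h)
  · exact G.x_ne_y ha (G.overPos_injective h).symm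
  · exact G.overPos_ne_underPos y x h
  · exact G.overPos_ne_underPos y y h

include ha hb hc hxz in
/-- The arc entering `underPos x` is not a side. [folklore] -/
theorem not_inT_inB : ¬ G.InT x y (G.inB x) := by
  unfold inB; rw [G.inT_arcIn_iff ha hb hc]
  rintro (h | h | h)
  · exact G.overPos_ne_underPos y x h.symm
  · exact G.overPos_ne_underPos z x h.symm
  · exact hxz (G.underPos_injective h)

include hxz in
/-- The arc leaving `overPos z` is not a side. [folklore] -/
theorem not_inT_outB : ¬ G.InT x y (G.outB z) := by
  unfold outB; rw [inT_arcOut_iff]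
  rintro (h | h | h)
  · exact hxz (G.overPos_injective h).symm
  · exact G.overPos_ne_underPos z x h
  · exact G.overPos_ne_underPos z y h

include ha hb hc in
/-- The arc entering `underPos y` is not a side. [folklore] -/
theorem not_inT_inC : ¬ G.InT x y (G.inC y) := by
  unfold inC; rw [G.inT_arcIn_iff ha hb hc]
  rintro (h | h | h)
  · exact G.overPos_ne_underPos y y h.symm
  · exact G.overPos_ne_underPos z y h.symm
  · exact G.y_ne_z hc (G.underPos_injective h)

include hc hxz in
/-- The arc leaving `underPos z` is not a side. [folklore] -/
theorem not_inT_outC : ¬ G.InT x y (G.outC z) := by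
  unfold outC; rw [inT_arcOut_iff]
  rintro (h | h | h)
  · exact G.overPos_ne_underPos x z h.symm
  · exact hxz (G.underPos_injective h).symm
  · exact G.y_ne_z hc (G.underPos_injective h).symm

include ha hb hc in
/-- A gluing at a passage of a fourth chord does not involve the sides of the triangle (in `G`
or in its braid rearrangement, which have the same gluings there). [folklore] -/
theorem not_inT_of_chordOf_ne {p : Fin (2 * G.n)} (hpx : G.chordOf p ≠ x) (hpy : G.chordOf p ≠ y)
    (hpz : G.chordOf p ≠ z) :
    ¬ G.InT x y (G.arcOut p) ∧ ¬ G.InT x y (G.arcIn p) ∧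
      ¬ G.InT x y (G.arcOut (G.partner p)) ∧ ¬ G.InT x y (G.arcIn (G.partner p)) := by
  refine ⟨fun h ↦ ?_, fun h ↦ ?_, fun h ↦ ?_, fun h ↦ ?_⟩
  · rw [inT_arcOut_iff] at h
    rcases h with rfl | rfl | rfl
    · exact hpx (G.chordOf_overPos x)
    · exact hpx (G.chordOf_underPos x)
    · exact hpy (G.chordOf_underPos y)
  · rw [G.inT_arcIn_iff ha hb hc] at h
    rcases h with rfl | rfl | rfl
    · exact hpy (G.chordOf_overPos y)
    · exact hpz (G.chordOf_overPos z)
    · exact hpz (G.chordOf_underPos z)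
  · rw [inT_arcOut_iff] at h
    rcases h with h | h | h
    · exact hpx (by rw [← chordOf_partner, h, chordOf_overPos])
    · exact hpx (by rw [← chordOf_partner, h, chordOf_underPos])
    · exact hpy (by rw [← chordOf_partner, h, chordOf_underPos])
  · rw [G.inT_arcIn_iff ha hb hc] at h
    rcases h with h | h | h
    · exact hpy (by rw [← chordOf_partner, h, chordOf_overPos])
    · exact hpz (by rw [← chordOf_partner, h, chordOf_overPos])
    · exact hpz (by rw [← chordOf_partner, h, chordOf_underPos])

variable (x y z) in
/-- A marked point is a passage of `x`, `y`, `z` or of a fourth chord. [folklore] -/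
theorem chordOf_cases (p : Fin (2 * G.n)) :
    (G.chordOf p ≠ x ∧ G.chordOf p ≠ y ∧ G.chordOf p ≠ z) ∨
      p = G.overPos x ∨ p = G.underPos x ∨ p = G.overPos y ∨ p = G.underPos y ∨
        p = G.overPos z ∨ p = G.underPos z := by
  by_cases h1 : G.chordOf p = x
  · rcases G.chordOf_spec p with h | h <;> rw [h1] at h
    · exact Or.inr (Or.inl h.symm)
    · exact Or.inr (Or.inr (Or.inl h.symm))
  by_cases h2 : G.chordOf p = y
  · rcases G.chordOf_spec p with h | h <;> rw [h2] at h
    · exact Or.inr (Or.inr (Or.inr (Or.inl h.symm)))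
    · exact Or.inr (Or.inr (Or.inr (Or.inr (Or.inl h.symm))))
  by_cases h3 : G.chordOf p = z
  · rcases G.chordOf_spec p with h | h <;> rw [h3] at h
    · exact Or.inr (Or.inr (Or.inr (Or.inr (Or.inr (Or.inl h.symm)))))
    · exact Or.inr (Or.inr (Or.inr (Or.inr (Or.inr (Or.inr h.symm)))))
  exact Or.inl ⟨h1, h2, h3⟩

include ha hb hc in
/-- A gluing of `G` at a passage of a fourth chord relates two arcs off the triangle. [folklore] -/
theorem not_inT_of_glueRel_of_ne (τ : G.State) {p : Fin (2 * G.n)} (hpx : G.chordOf p ≠ x)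
    (hpy : G.chordOf p ≠ y) (hpz : G.chordOf p ≠ z) {u v : G.Arc} (h : G.glueRel τ p u v) :
    ¬ G.InT x y u ∧ ¬ G.InT x y v := by
  obtain ⟨h1, h2, h3, h4⟩ := G.not_inT_of_chordOf_ne ha hb hc hpx hpy hpz
  unfold glueRel at h
  rcases h with ⟨-, ⟨rfl, rfl⟩ | ⟨rfl, rfl⟩⟩ | ⟨-, ⟨rfl, rfl⟩ | ⟨rfl, rfl⟩⟩
  · exact ⟨h2, h3⟩
  · exact ⟨h3, h2⟩
  · exact ⟨h2, h4⟩
  · exact ⟨h1, h3⟩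

/-- At a passage of a fourth chord the braid rearrangement has the gluings of `G`. [folklore] -/
theorem glueRel_braidMove_of_ne (τ : G.State) {p : Fin (2 * G.n)} (hpx : G.chordOf p ≠ x)
    (hpy : G.chordOf p ≠ y) (hpz : G.chordOf p ≠ z) (u v : G.Arc) :
    (G.braidMove x y z).glueRel τ p u v ↔ G.glueRel τ p u v := by
  have hfix : G.braidPerm x y z p = p :=
    G.braidPerm_apply_of_ne hpx hpy hpz p (by
      rcases G.chordOf_spec p with h | h
      · exact Or.inl h.symm
      · exact Or.inr h.symm)
  have hc' : (G.braidMove x y z).chordOf p = G.chordOf p := by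
    rcases G.chordOf_spec p with h | h
    · conv_lhs => rw [← h]
      have e : (G.braidMove x y z).overPos (G.chordOf p) = G.overPos (G.chordOf p) :=
        G.overPos_braidMove_of_ne hpx hpy hpz
      rw [← e, chordOf_overPos]
    · conv_lhs => rw [← h]
      have e : (G.braidMove x y z).underPos (G.chordOf p) = G.underPos (G.chordOf p) :=
        G.underPos_braidMove_of_ne hpx hpy hpz
      rw [← e, chordOf_underPos]
  have hp' : (G.braidMove x y z).partner p = G.partner p := by
    have e : (G.braidMove x y z).overPos (G.chordOf p) = G.overPos (G.chordOf p) :=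
      G.overPos_braidMove_of_ne hpx hpy hpz
    have e' : (G.braidMove x y z).underPos (G.chordOf p) = G.underPos (G.chordOf p) :=
      G.underPos_braidMove_of_ne hpx hpy hpz
    unfold partner
    rw [hc', e, e']
    split_ifs with h1 h2 h3
    · rfl
    · exact absurd h1 h2
    · exact absurd h3 h1
    · rfl
  unfold glueRel
  rw [hc', hp']
  rfl

include ha hb hc hxz hx hy hz in
/-- **In the resolution `(x, y, z) = (1, 0, 1)` of `G` the three sides of the triangle form a state
circle by themselves**: adjacency preserves membership in the triangle. Khovanov (2000), §5.4;
Bar-Natan (2002), §4.4. [cite: Khovanov2000, §5.4] -/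
theorem inT_iff_of_adj {τ : G.State} (hxT : τ x = true) (hyT : τ y = false) (hzT : τ z = true)
    {u v : G.Arc} (h : (G.stateGraph τ).Adj u v) : G.InT x y u ↔ G.InT x y v := by
  have hA := G.not_inT_inA hxz ha hb hc; have hA' := G.not_inT_outA ha
  have hB := G.not_inT_inB hxz ha hb hc; have hB' := G.not_inT_outB (y := y) hxz
  have hC := G.not_inT_inC ha hb hc; have hC' := G.not_inT_outC hxz hc
  have sA := G.inT_sideA (x := x) (y := y); have sB := G.inT_sideB (x := x) (y := y)
  have sC := G.inT_sideC (x := x) (y := y)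
  rw [stateGraph_adj] at h
  obtain ⟨-, p, hp⟩ := h
  -- reduce to one orientation
  suffices key : ∀ u v, G.glueRel τ p u v → (G.InT x y u ↔ G.InT x y v) by
    rcases hp with hp | hp
    · exact key _ _ hp
    · exact (key _ _ hp).symm
  intro u v hp
  rcases G.chordOf_cases x y z p with ⟨h1, h2, h3⟩ | rfl | rfl | rfl | rfl | rfl | rfl
  · obtain ⟨hu, hv⟩ := G.not_inT_of_glueRel_of_ne ha hb hc τ h1 h2 h3 hp
    exact ⟨fun h ↦ (hu h).elim, fun h ↦ (hv h).elim⟩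
  · rw [G.glueRel_overPos_x hx, hxT] at hp
    rcases hp with ⟨h', -⟩ | ⟨-, ⟨rfl, rfl⟩ | ⟨rfl, rfl⟩⟩
    · exact Bool.noConfusion h'
    · exact ⟨fun h ↦ (hA h).elim, fun h ↦ (hB h).elim⟩
    · exact ⟨fun _ ↦ sB, fun _ ↦ sA⟩
  · rw [G.glueRel_underPos_x hx, hxT] at hp
    rcases hp with ⟨h', -⟩ | ⟨-, ⟨rfl, rfl⟩ | ⟨rfl, rfl⟩⟩
    · exact Bool.noConfusion h'
    · exact ⟨fun h ↦ (hB h).elim, fun h ↦ (hA h).elim⟩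
    · exact ⟨fun _ ↦ sA, fun _ ↦ sB⟩
  · rw [G.glueRel_overPos_y ha hy, hyT] at hp
    rcases hp with ⟨-, ⟨rfl, rfl⟩ | ⟨rfl, rfl⟩⟩ | ⟨h', -⟩
    · exact ⟨fun _ ↦ sC, fun _ ↦ sA⟩
    · exact ⟨fun _ ↦ sA, fun _ ↦ sC⟩
    · exact Bool.noConfusion h'
  · rw [G.glueRel_underPos_y ha hy, hyT] at hp
    rcases hp with ⟨-, ⟨rfl, rfl⟩ | ⟨rfl, rfl⟩⟩ | ⟨h', -⟩
    · exact ⟨fun h ↦ (hC h).elim, fun h ↦ (hA' h).elim⟩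
    · exact ⟨fun h ↦ (hA' h).elim, fun h ↦ (hC h).elim⟩
    · exact Bool.noConfusion h'
  · rw [G.glueRel_overPos_z hb hc hz, hzT] at hp
    rcases hp with ⟨h', -⟩ | ⟨-, ⟨rfl, rfl⟩ | ⟨rfl, rfl⟩⟩
    · exact Bool.noConfusion h'
    · exact ⟨fun _ ↦ sC, fun _ ↦ sB⟩
    · exact ⟨fun h ↦ (hB' h).elim, fun h ↦ (hC' h).elim⟩
  · rw [G.glueRel_underPos_z hb hc hz, hzT] at hp
    rcases hp with ⟨h', -⟩ | ⟨-, ⟨rfl, rfl⟩ | ⟨rfl, rfl⟩⟩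
    · exact Bool.noConfusion h'
    · exact ⟨fun _ ↦ sB, fun _ ↦ sC⟩
    · exact ⟨fun h ↦ (hC' h).elim, fun h ↦ (hB' h).elim⟩

include ha hb hc hxz hx hy hz in
/-- **In the resolution `(x, y, z) = (1, 0, 1)` of the braid rearrangement the three sides form a
state circle by themselves.** [cite: Khovanov2000, §5.4] -/
theorem inT_iff_of_adj_braidMove {τ : G.State} (hxT : τ x = true) (hyT : τ y = false) (hzT : τ z = true)
    {u v : G.Arc} (h : ((G.braidMove x y z).stateGraph τ).Adj u v) : G.InT x y u ↔ G.InT x y v := by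
  have hA := G.not_inT_inA hxz ha hb hc; have hA' := G.not_inT_outA ha
  have hB := G.not_inT_inB hxz ha hb hc; have hB' := G.not_inT_outB (y := y) hxz
  have hC := G.not_inT_inC ha hb hc; have hC' := G.not_inT_outC hxz hc
  have sA := G.inT_sideA (x := x) (y := y); have sB := G.inT_sideB (x := x) (y := y)
  have sC := G.inT_sideC (x := x) (y := y)
  rw [stateGraph_adj] at h
  obtain ⟨-, p, hp⟩ := h
  suffices key : ∀ u v, (G.braidMove x y z).glueRel τ p u v → (G.InT x y u ↔ G.InT x y v) by
    rcases hp with hp | hp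
    · exact key _ _ hp
    · exact (key _ _ hp).symm
  intro u v hp
  rcases G.chordOf_cases x y z p with ⟨h1, h2, h3⟩ | rfl | rfl | rfl | rfl | rfl | rfl
  · rw [G.glueRel_braidMove_of_ne τ h1 h2 h3] at hp
    obtain ⟨hu, hv⟩ := G.not_inT_of_glueRel_of_ne ha hb hc τ h1 h2 h3 hp
    exact ⟨fun h ↦ (hu h).elim, fun h ↦ (hv h).elim⟩
  · rw [G.glueRel_braidMove_overPos_x hxz hc hy, hyT] at hp
    rcases hp with ⟨-, ⟨rfl, rfl⟩ | ⟨rfl, rfl⟩⟩ | ⟨h', -⟩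
    · exact ⟨fun h ↦ (hA h).elim, fun h ↦ (hC' h).elim⟩
    · exact ⟨fun h ↦ (hC' h).elim, fun h ↦ (hA h).elim⟩
    · exact Bool.noConfusion h'
  · rw [G.glueRel_braidMove_underPos_x ha hz, hzT] at hp
    rcases hp with ⟨h', -⟩ | ⟨-, ⟨rfl, rfl⟩ | ⟨rfl, rfl⟩⟩
    · exact Bool.noConfusion h'
    · exact ⟨fun h ↦ (hB h).elim, fun h ↦ (hC h).elim⟩
    · exact ⟨fun _ ↦ sC, fun _ ↦ sB⟩
  · rw [G.glueRel_braidMove_overPos_y hxz ha hb hc hx, hxT] at hp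
    rcases hp with ⟨h', -⟩ | ⟨-, ⟨rfl, rfl⟩ | ⟨rfl, rfl⟩⟩
    · exact Bool.noConfusion h'
    · exact ⟨fun _ ↦ sB, fun _ ↦ sA⟩
    · exact ⟨fun h ↦ (hA' h).elim, fun h ↦ (hB' h).elim⟩
  · rw [G.glueRel_braidMove_underPos_y ha hz, hzT] at hp
    rcases hp with ⟨h', -⟩ | ⟨-, ⟨rfl, rfl⟩ | ⟨rfl, rfl⟩⟩
    · exact Bool.noConfusion h'
    · exact ⟨fun h ↦ (hC h).elim, fun h ↦ (hB h).elim⟩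
    · exact ⟨fun _ ↦ sB, fun _ ↦ sC⟩
  · rw [G.glueRel_braidMove_overPos_z hxz ha hb hc hx, hxT] at hp
    rcases hp with ⟨h', -⟩ | ⟨-, ⟨rfl, rfl⟩ | ⟨rfl, rfl⟩⟩
    · exact Bool.noConfusion h'
    · exact ⟨fun _ ↦ sA, fun _ ↦ sB⟩
    · exact ⟨fun h ↦ (hB' h).elim, fun h ↦ (hA' h).elim⟩
  · rw [G.glueRel_braidMove_underPos_z hxz hc hy, hyT] at hp
    rcases hp with ⟨-, ⟨rfl, rfl⟩ | ⟨rfl, rfl⟩⟩ | ⟨h', -⟩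
    · exact ⟨fun _ ↦ sA, fun _ ↦ sC⟩
    · exact ⟨fun _ ↦ sC, fun _ ↦ sA⟩
    · exact Bool.noConfusion h'

include ha hb hc hxz hx hy hz in
/-- Reachability preserves membership in the triangle, resolution `(1, 0, 1)` of `G`. [folklore] -/
theorem inT_iff_of_reachable {τ : G.State} (hxT : τ x = true) (hyT : τ y = false) (hzT : τ z = true)
    {u v : G.Arc} (h : (G.stateGraph τ).Reachable u v) : G.InT x y u ↔ G.InT x y v := by
  obtain ⟨w⟩ := h
  induction w with
  | nil => rfl
  | cons hadj _ ih => exact (G.inT_iff_of_adj hxz ha hb hc hx hy hz hxT hyT hzT hadj).trans ih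

include ha hb hc hxz hx hy hz in
/-- Reachability preserves membership in the triangle, resolution `(1, 0, 1)` of the braid
rearrangement. [folklore] -/
theorem inT_iff_of_reachable_braidMove {τ : G.State} (hxT : τ x = true) (hyT : τ y = false)
    (hzT : τ z = true) {u v : G.Arc} (h : ((G.braidMove x y z).stateGraph τ).Reachable u v) :
    G.InT x y u ↔ G.InT x y v := by
  obtain ⟨w⟩ := h
  induction w with
  | nil => rfl
  | cons hadj _ ih =>
    exact (G.inT_iff_of_adj_braidMove hxz ha hb hc hx hy hz hxT hyT hzT hadj).trans ih

/-- The first two sides are distinct arcs. [folklore] -/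
theorem sideA_ne_sideB : G.sideA x ≠ G.sideB x := fun h ↦
  G.overPos_ne_underPos x x (G.arcOut_injective h)

include ha in
/-- The last two sides are distinct arcs. [folklore] -/
theorem sideB_ne_sideC : G.sideB x ≠ G.sideC y := fun h ↦
  G.x_ne_y ha (G.underPos_injective (G.arcOut_injective h))

include hx in
/-- When `x` is `1`-smoothed the first two sides are glued (in `G`). [folklore] -/
theorem adj_sideA_sideB {τ : G.State} (hxT : τ x = true) :
    (G.stateGraph τ).Adj (G.sideA x) (G.sideB x) := by
  rw [stateGraph_adj]
  exact ⟨G.sideA_ne_sideB, G.overPos x,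
    Or.inl ((G.glueRel_overPos_x hx τ _ _).2 (Or.inr ⟨hxT, Or.inr ⟨rfl, rfl⟩⟩))⟩

include hxz ha hb hc hx in
/-- When `x` is `1`-smoothed the first two sides are glued (in the braid rearrangement). [folklore] -/
theorem adj_sideA_sideB_braidMove {τ : G.State} (hxT : τ x = true) :
    ((G.braidMove x y z).stateGraph τ).Adj (G.sideA x) (G.sideB x) := by
  rw [stateGraph_adj]
  exact ⟨G.sideA_ne_sideB, G.overPos y,
    Or.inl ((G.glueRel_braidMove_overPos_y hxz ha hb hc hx τ _ _).2 (Or.inr ⟨hxT, Or.inl ⟨rfl, rfl⟩⟩))⟩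

include ha hb hc hz in
/-- When `z` is `1`-smoothed the last two sides are glued (in `G`). [folklore] -/
theorem adj_sideB_sideC {τ : G.State} (hzT : τ z = true) :
    (G.stateGraph τ).Adj (G.sideB x) (G.sideC y) := by
  rw [stateGraph_adj]
  exact ⟨G.sideB_ne_sideC ha, G.overPos z,
    Or.inl ((G.glueRel_overPos_z hb hc hz τ _ _).2 (Or.inr ⟨hzT, Or.inl ⟨rfl, rfl⟩⟩))⟩

include ha hz in
/-- When `z` is `1`-smoothed the last two sides are glued (in the braid rearrangement). [folklore] -/
theorem adj_sideB_sideC_braidMove {τ : G.State} (hzT : τ z = true) :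
    ((G.braidMove x y z).stateGraph τ).Adj (G.sideB x) (G.sideC y) := by
  rw [stateGraph_adj]
  exact ⟨G.sideB_ne_sideC ha, G.underPos x,
    Or.inl ((G.glueRel_braidMove_underPos_x ha hz τ _ _).2 (Or.inr ⟨hzT, Or.inr ⟨rfl, rfl⟩⟩))⟩

include ha hb hc hxz hx hy hz in
/-- **In the resolution `(1, 0, 1)` of `G` an arc lies on the circle of the first side iff it
is a side of the triangle.** Khovanov (2000), §5.4. [cite: Khovanov2000, §5.4] -/
theorem circleOf_eq_sideA_iff {τ : G.State} (hxT : τ x = true) (hyT : τ y = false) (hzT : τ z = true)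
    (u : G.Arc) : G.circleOf τ u = G.circleOf τ (G.sideA x) ↔ G.InT x y u := by
  rw [circleOf_eq_iff]
  constructor
  · intro h
    exact (G.inT_iff_of_reachable hxz ha hb hc hx hy hz hxT hyT hzT h).2 G.inT_sideA
  · rintro (rfl | rfl | rfl)
    · rfl
    · exact (G.adj_sideA_sideB hx hxT).reachable.symm
    · exact ((G.adj_sideA_sideB hx hxT).reachable.trans
        (G.adj_sideB_sideC ha hb hc hz hzT).reachable).symm

include ha hb hc hxz hx hy hz in
/-- **In the resolution `(1, 0, 1)` of the braid rearrangement an arc lies on the circle of the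
first side iff it is a side of the triangle.** [cite: Khovanov2000, §5.4] -/
theorem circleOf_braidMove_eq_sideA_iff {τ : G.State} (hxT : τ x = true) (hyT : τ y = false)
    (hzT : τ z = true) (u : G.Arc) :
    (G.braidMove x y z).circleOf τ u = (G.braidMove x y z).circleOf τ (G.sideA x) ↔ G.InT x y u := by
  rw [circleOf_eq_iff]
  constructor
  · intro h
    exact (G.inT_iff_of_reachable_braidMove hxz ha hb hc hx hy hz hxT hyT hzT h).2 G.inT_sideA
  · rintro (rfl | rfl | rfl)
    · rfl
    · exact (G.adj_sideA_sideB_braidMove hxz ha hb hc hx hxT).reachable.symm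
    · exact ((G.adj_sideA_sideB_braidMove hxz ha hb hc hx hxT).reachable.trans
        (G.adj_sideB_sideC_braidMove ha hz hzT).reachable).symm

include ha hb hc hxz hx hy hz in
/-- Arcs one on and one off the triangle lie on different circles, resolution `(1, 0, 1)` of
`G`. [folklore] -/
theorem circleOf_ne_of_inT {τ : G.State} (hxT : τ x = true) (hyT : τ y = false) (hzT : τ z = true)
    {u v : G.Arc} (hu : G.InT x y u) (hv : ¬ G.InT x y v) : G.circleOf τ u ≠ G.circleOf τ v := by
  intro h
  rw [(G.circleOf_eq_sideA_iff hxz ha hb hc hx hy hz hxT hyT hzT u).2 hu] at h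
  exact hv ((G.circleOf_eq_sideA_iff hxz ha hb hc hx hy hz hxT hyT hzT v).1 h.symm)

include ha hb hc hxz hx hy hz in
/-- Arcs one on and one off the triangle lie on different circles, resolution `(1, 0, 1)` of the
braid rearrangement. [folklore] -/
theorem circleOf_braidMove_ne_of_inT {τ : G.State} (hxT : τ x = true) (hyT : τ y = false)
    (hzT : τ z = true) {u v : G.Arc} (hu : G.InT x y u) (hv : ¬ G.InT x y v) :
    (G.braidMove x y z).circleOf τ u ≠ (G.braidMove x y z).circleOf τ v := by
  intro h
  rw [(G.circleOf_braidMove_eq_sideA_iff hxz ha hb hc hx hy hz hxT hyT hzT u).2 hu] at h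
  exact hv ((G.circleOf_braidMove_eq_sideA_iff hxz ha hb hc hx hy hz hxT hyT hzT v).1 h.symm)

/-! ## Splitting off and merging back the small circle -/

include ha hb hc hxz hx hy hz in
/-- **Flipping `x` from the resolution `(0, 0, 1)` of `G` is a split** (it splits off the small
circle of the triangle), for every state of the other chords. Khovanov (2000), §5.4;
Bar-Natan (2002), §4.4. [cite: Khovanov2000, §5.4] -/
theorem isSplitAt_x {τ : G.State} (hxF : τ x = false) (hyT : τ y = false) (hzT : τ z = true) :
    G.IsSplitAt τ x := by
  refine ⟨hxF, ?_⟩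
  have h1 : Function.update τ x true y = false := by
    rw [Function.update_of_ne (G.x_ne_y ha).symm]; exact hyT
  have h2 : Function.update τ x true z = true := by
    rw [Function.update_of_ne (fun h ↦ hxz h.symm)]; exact hzT
  exact (G.circleOf_ne_of_inT hxz ha hb hc hx hy hz (Function.update_self ..) h1 h2
    G.inT_sideA (G.not_inT_inA hxz ha hb hc)).symm

include ha hb hc hxz hx hy hz in
/-- **Flipping `x` from the resolution `(0, 0, 1)` of the braid rearrangement is a split.**
[cite: Khovanov2000, §5.4] -/
theorem isSplitAt_x_braidMove {τ : G.State} (hxF : τ x = false) (hyT : τ y = false) (hzT : τ z = true) :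
    (G.braidMove x y z).IsSplitAt τ x := by
  refine ⟨hxF, ?_⟩
  have h1 : Function.update τ x true y = false := by
    rw [Function.update_of_ne (G.x_ne_y ha).symm]; exact hyT
  have h2 : Function.update τ x true z = true := by
    rw [Function.update_of_ne (fun h ↦ hxz h.symm)]; exact hzT
  rw [G.overPos_braidMove_x hxz, arcIn_braidMove, arcOut_braidMove, G.arcIn_overPos_y ha]
  exact G.circleOf_braidMove_ne_of_inT hxz ha hb hc hx hy hz (Function.update_self ..) h1 h2
    G.inT_sideA (G.not_inT_outA ha)

include ha hb hc hxz hx hy hz in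
/-- **Flipping `y` from the resolution `(1, 0, 1)` of `G` is a merge** (it merges the small circle
back). [cite: Khovanov2000, §5.4] -/
theorem isMergeAt_y {τ : G.State} (hxT : τ x = true) (hyF : τ y = false) (hzT : τ z = true) :
    G.IsMergeAt τ y := by
  refine ⟨hyF, ?_⟩
  rw [G.arcIn_overPos_y ha]
  exact G.circleOf_ne_of_inT hxz ha hb hc hx hy hz hxT hyF hzT G.inT_sideA (G.not_inT_outA ha)

include ha hb hc hxz hx hy hz in
/-- **Flipping `y` from the resolution `(1, 0, 1)` of the braid rearrangement is a merge.**
[cite: Khovanov2000, §5.4] -/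
theorem isMergeAt_y_braidMove {τ : G.State} (hxT : τ x = true) (hyF : τ y = false) (hzT : τ z = true) :
    (G.braidMove x y z).IsMergeAt τ y := by
  refine ⟨hyF, ?_⟩
  rw [G.overPos_braidMove_y (G.y_ne_z hc), arcIn_braidMove, arcOut_braidMove]
  exact (G.circleOf_braidMove_ne_of_inT hxz ha hb hc hx hy hz hxT hyF hzT G.inT_sideA
    (G.not_inT_inA hxz ha hb hc)).symm


end Loop

end GaussDiagram

end Literature.Topology.FourManifolds
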